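import Mathlib

/-!
# Stub `stub_primeAbove` — the prime of `ℚ(ζ₃, ∛(pq))` above an inert prime `p ≡ 2 (mod 3)`

Helper file for the line `Sketch` (honda-leak arm) of the crux `PureCubicClassNumberHard`
(`Summit.QuantumAdvantage.QuantumAdvantage.Theses.LinnikCubicClassGroups`, skeleton v3).

In a number field `N` of degree `6` containing `ζ` (`ζ² + ζ + 1 = 0`) and `θ` (`θ³ = pq`,
`p ≠ q` primes), with a `ℚ`-automorphism `σ` satisfying `σ³ = 1`, and for a prime
`p ≡ 2 (mod 3)`: a maximal ideal `w ∋ p` of `𝓞 N` is the unique prime above `p`, `(p) = w³`,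
`#(𝓞 N ⧸ w) = p²`, and `σ y ≡ y (mod w)` for every `y ∈ 𝓞 N`.

Proof.  `3 · v_w(θ) = v_w(p) + v_w(q) = e(w | p)` gives `3 ∣ e`; `ζ mod w` has order `3` in the
residue field with `p^f` elements, so `3 ∣ p^f − 1` and `f ≠ 1` as `p ≡ 2 (mod 3)`; the
fundamental identity `∑ e f = 6` then leaves exactly one prime, with `e = 3`, `f = 2`, whence
`(p) = w³` (unique factorisation of ideals) and `#(𝓞 N ⧸ w) = p²`.  Finally `σ` fixes `w`
(uniqueness), so it induces a ring automorphism of `𝓞 N ⧸ w ≅ 𝔽_{p²}` of order dividing `3`;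
but `Aut(𝔽_{p²})` has order `2`, so the induced automorphism is trivial.
-/

set_option linter.dupNamespace false

noncomputable section

open NumberField IsDedekindDomain UniqueFactorizationMonoid Polynomial

namespace Summit.QuantumAdvantage.QuantumAdvantage.Theorems.LinnikCubicClassGroups

variable {N : Type*} [Field N] [NumberField N]

omit [NumberField N] in
/-- A maximal ideal of `𝓞 N` containing the rational prime `p` lies over `pℤ`. [folklore] -/
private theorem liesOver_span_of_natCast_mem {p : ℕ} (hp : p.Prime) (w : Ideal (𝓞 N))
    [hw : w.IsMaximal] (hpw : (p : 𝓞 N) ∈ w) : w.LiesOver (Ideal.span {(p : ℤ)}) := by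
  have hpZ : Prime (p : ℤ) := Nat.prime_iff_prime_int.mp hp
  have hmax : (Ideal.span {(p : ℤ)}).IsMaximal :=
    ((Ideal.span_singleton_prime hpZ.ne_zero).mpr hpZ).isMaximal (by simpa using hpZ.ne_zero)
  refine ⟨hmax.eq_of_le (Ideal.comap_ne_top _ hw.ne_top) ?_⟩
  rw [Ideal.span_singleton_le_iff_mem, Ideal.under_def, Ideal.mem_comap, map_natCast]
  exact hpw

/-- **`3 ∣ e(w | p)` when `∛(pq) ∈ N`.**  If `α³ = pq` in `N` (`p ≠ q` primes), every maximal
ideal `w ∋ p` of `𝓞 N` has ramification index divisible by `3`: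
`3 · v_w(α) = v_w(p) + v_w(q) = e(w | p)` since `q ∉ w`. [folklore] -/
private theorem three_dvd_ramificationIdx {p q : ℕ} (hp : p.Prime) (hq : q.Prime) (hpq : p ≠ q)
    {α : N} (hα : α ^ 3 = ((p * q : ℕ) : N)) (w : Ideal (𝓞 N)) [hw : w.IsMaximal]
    (hpw : (p : 𝓞 N) ∈ w) : 3 ∣ w.ramificationIdx ℤ := by
  -- adapted from Literature/NumberTheory/NumberFields/PureCubicClassNumberModThreeProofs.lean
  -- (`Honda1971.ramificationIdx_eq_three`)
  classical
  obtain ⟨θ, hθ⟩ : ∃ θ : 𝓞 N, (θ : N) = α := by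
    have hint : IsIntegral ℤ α := by
      refine ⟨X ^ 3 - C ((p * q : ℕ) : ℤ), monic_X_pow_sub_C _ (by norm_num), ?_⟩
      simp [hα]
    exact ⟨⟨α, hint⟩, rfl⟩
  have hθ3 : θ ^ 3 = (p : 𝓞 N) * (q : 𝓞 N) := by
    apply RingOfIntegers.coe_injective
    have h := hα
    rw [← hθ] at h
    push_cast at h ⊢
    exact_mod_cast h
  have hp0 : (p : 𝓞 N) ≠ 0 := by exact_mod_cast hp.ne_zero
  have hq0 : (q : 𝓞 N) ≠ 0 := by exact_mod_cast hq.ne_zero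
  have hw0 : w ≠ ⊥ := by
    rintro rfl
    exact hp0 (Ideal.mem_bot.mp hpw)
  let v : HeightOneSpectrum (𝓞 N) := ⟨w, hw.isPrime, hw0⟩
  set P : Ideal ℤ := Ideal.span {(p : ℤ)} with hPdef
  haveI : w.LiesOver P := liesOver_span_of_natCast_mem hp w hpw
  have hPmap : P.map (algebraMap ℤ (𝓞 N)) = Ideal.span {(p : 𝓞 N)} := by
    rw [hPdef, Ideal.map_span, Set.image_singleton, map_natCast]
  have hPmap0 : P.map (algebraMap ℤ (𝓞 N)) ≠ ⊥ := by
    rw [hPmap, Ne, Ideal.span_singleton_eq_bot]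
    exact hp0
  -- `v(p) = exp(-e)`
  have he : w.ramificationIdx ℤ = multiplicity w (Ideal.span {(p : 𝓞 N)}) := by
    rw [Ideal.IsDedekindDomain.ramificationIdx_eq_multiplicity P w hPmap0, hPmap]
  have hvp : v.intValuation (p : 𝓞 N) = WithZero.exp (-(w.ramificationIdx ℤ : ℤ)) := by
    rw [he]
    exact v.intValuation_eq_exp_neg_multiplicity hp0
  -- `v(q) = 1`
  have hqw : (q : 𝓞 N) ∉ w := by
    intro hqv
    have h' : IsCoprime (p : ℤ) (q : ℤ) :=
      Nat.isCoprime_iff_coprime.mpr ((Nat.coprime_primes hp hq).mpr hpq)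
    have hcop : IsCoprime (p : 𝓞 N) (q : 𝓞 N) := by
      simpa using h'.map (algebraMap ℤ (𝓞 N))
    obtain ⟨a, b, hab⟩ := hcop
    exact hw.ne_top ((Ideal.eq_top_iff_one _).mpr
      (hab ▸ w.add_mem (w.mul_mem_left a hpw) (w.mul_mem_left b hqv)))
  have hvq : v.intValuation (q : 𝓞 N) = 1 :=
    HeightOneSpectrum.intValuation_eq_one_iff.mpr hqw
  -- `v(θ) = exp(-m)` and `v(θ)³ = v(p) v(q)`
  have hθ0 : θ ≠ 0 := by
    rintro rfl
    rw [zero_pow (by norm_num)] at hθ3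
    exact mul_ne_zero hp0 hq0 hθ3.symm
  have hvθ := v.intValuation_eq_exp_neg_multiplicity hθ0
  set m : ℕ := multiplicity v.asIdeal (Ideal.span {θ}) with hmdef
  have hval : WithZero.exp (-(m : ℤ)) ^ 3 = WithZero.exp (-(w.ramificationIdx ℤ : ℤ)) := by
    rw [← hvθ, ← map_pow, hθ3, map_mul, hvp, hvq, mul_one]
  rw [← WithZero.exp_nsmul, WithZero.exp_inj] at hval
  have h3dvd : (w.ramificationIdx ℤ : ℤ) = 3 * m := by
    rw [nsmul_eq_mul] at hval
    push_cast at hval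
    linarith
  exact ⟨m, by exact_mod_cast h3dvd⟩

/-- **A primitive cube root of unity keeps order `3` modulo every prime not above `3`.**  If
`ω² + ω + 1 = 0` in a commutative ring `R` and `P` is a prime ideal containing a rational prime
`p` coprime to `3`, then `ω mod P` has multiplicative order `3`. [folklore] -/
private theorem orderOf_mk_eq_three {R : Type*} [CommRing R] {ω : R} (hω : ω ^ 2 + ω + 1 = 0)
    (P : Ideal R) [hP : P.IsPrime] {p : ℕ} (hp : (p : R) ∈ P) (hp3 : Nat.Coprime p 3) :
    orderOf (Ideal.Quotient.mk P ω) = 3 := by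
  -- adapted from Literature/NumberTheory/NumberFields/PureCubicClassNumberModThreeProofs.lean
  -- (`Honda1971.orderOf_mk_eq_three`)
  haveI : Fact (Nat.Prime 3) := ⟨Nat.prime_three⟩
  have hω3 : ω ^ 3 = 1 := by linear_combination (ω - 1) * hω
  refine orderOf_eq_prime ?_ ?_
  · rw [← map_pow, hω3, map_one]
  · intro h1
    have hmem : ω - 1 ∈ P := by
      rw [← Ideal.Quotient.eq, h1, map_one]
    have h3ω : (3 : R) * ω ∈ P := by
      have h : (3 : R) * ω = (ω ^ 2 + ω + 1) - (ω - 1) * (ω - 1) := by ring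
      rw [h, hω, zero_sub]
      exact P.neg_mem (P.mul_mem_left (ω - 1) hmem)
    have hωP : ω ∉ P := fun h => hP.ne_top ((Ideal.eq_top_iff_one _).mpr (by
      have h' : ω ^ 3 ∈ P := P.pow_mem_of_mem h 3 (by norm_num)
      rwa [hω3] at h'))
    have h3 : (3 : R) ∈ P := (hP.mem_or_mem h3ω).resolve_right hωP
    have hcop : IsCoprime (p : R) (3 : R) := by
      have h' : IsCoprime (p : ℤ) (3 : ℤ) := Nat.isCoprime_iff_coprime.mpr hp3
      simpa using h'.map (Int.castRingHom R)
    obtain ⟨a, b, hab⟩ := hcop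
    exact hP.ne_top ((Ideal.eq_top_iff_one _).mpr
      (hab ▸ P.add_mem (P.mul_mem_left a hp) (P.mul_mem_left b h3)))

/-- **`f(w | p) ≥ 2` when `ζ₃ ∈ N` and `p ≡ 2 (mod 3)`.**  If `ζ² + ζ + 1 = 0` in `N`, every
maximal ideal `w ∋ p` of `𝓞 N` has residue degree at least `2`: `ζ mod w` has order `3` in the
residue field with `p^f` elements, so `3 ∣ p^f − 1`, impossible for `f = 1`. [folklore] -/
private theorem two_le_inertiaDeg {p : ℕ} (hp : p.Prime) (hp3 : p % 3 = 2) {ζ : N}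
    (hζ : ζ ^ 2 + ζ + 1 = 0) (w : Ideal (𝓞 N)) [hw : w.IsMaximal] (hpw : (p : 𝓞 N) ∈ w) :
    2 ≤ w.inertiaDeg ℤ := by
  classical
  obtain ⟨z, hz⟩ : ∃ z : 𝓞 N, (z : N) = ζ := by
    have hζ3 : ζ ^ 3 = 1 := by linear_combination (ζ - 1) * hζ
    have hint : IsIntegral ℤ ζ := by
      refine ⟨X ^ 3 - C 1, monic_X_pow_sub_C _ (by norm_num), ?_⟩
      simp [hζ3]
    exact ⟨⟨ζ, hint⟩, rfl⟩
  have hz2 : z ^ 2 + z + 1 = 0 := by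
    apply RingOfIntegers.coe_injective
    have h := hζ
    rw [← hz] at h
    push_cast at h ⊢
    exact_mod_cast h
  haveI : w.LiesOver (Ideal.span {(p : ℤ)}) := liesOver_span_of_natCast_mem hp w hpw
  -- `#(𝓞 N ⧸ w) = p ^ f`
  have hcard : Nat.card (𝓞 N ⧸ w) = p ^ w.inertiaDeg ℤ := by
    rw [← Submodule.cardQuot_apply, ← Ideal.absNorm_apply, Ideal.pow_inertiaDeg p w]
  -- `ζ mod w` is a unit of order `3`
  have hcop : Nat.Coprime p 3 := (Nat.coprime_primes hp Nat.prime_three).mpr (by omega)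
  have hord : orderOf (Ideal.Quotient.mk w z) = 3 := orderOf_mk_eq_three hz2 w hpw hcop
  have hfin : IsOfFinOrder (Ideal.Quotient.mk w z) := orderOf_pos_iff.mp (by omega)
  obtain ⟨u, hu⟩ := hfin.isUnit
  have hu3 : orderOf u = 3 := by rw [← orderOf_units, hu, hord]
  -- `3 ∣ p ^ f - 1`
  letI := Ideal.Quotient.field w
  have hdvd : 3 ∣ p ^ w.inertiaDeg ℤ - 1 := by
    rw [← hcard, ← Nat.card_units (𝓞 N ⧸ w), ← hu3]
    exact orderOf_dvd_natCard u
  have hf0 : 0 < w.inertiaDeg ℤ := Ideal.inertiaDeg_pos w ℤ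
  by_contra hlt
  have hf1 : w.inertiaDeg ℤ = 1 := by omega
  rw [hf1, pow_one] at hdvd
  omega

/-- **A ring endomorphism `g` with `g³ = 1` of a field with `p²` elements is the identity**:
`g` is an `𝔽_p`-algebra automorphism, `Aut(𝔽_{p²}/𝔽_p)` has order `[𝔽_{p²} : 𝔽_p] = 2`, and
`gcd(2, 3) = 1`. [folklore] -/
private theorem apply_eq_self_of_card_eq_sq {F : Type*} [Field F] [Finite F] {p : ℕ}
    [hp : Fact p.Prime] [CharP F p] (hcard : Nat.card F = p ^ 2) (g : F →+* F)
    (hg : ∀ x, g (g (g x)) = x) (x : F) : g x = x := by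
  letI : Algebra (ZMod p) F := ZMod.algebra F p
  have hfin : Module.finrank (ZMod p) F = 2 := by
    have h := FiniteField.pow_finrank_eq_natCard p F
    rw [hcard] at h
    exact Nat.pow_right_injective hp.out.two_le h
  -- `g` as a `ZMod p`-algebra automorphism
  have hcomm : ∀ r : ZMod p, g (algebraMap (ZMod p) F r) = algebraMap (ZMod p) F r := fun r =>
    RingHom.congr_fun (Subsingleton.elim (g.comp (algebraMap (ZMod p) F))
      (algebraMap (ZMod p) F)) r
  let g' : F →ₐ[ZMod p] F := ⟨g, hcomm⟩
  have hbij : Function.Bijective g' := Finite.injective_iff_bijective.mp g.injective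
  let e : F ≃ₐ[ZMod p] F := AlgEquiv.ofBijective g' hbij
  have he : ∀ y, e y = g y := fun y => rfl
  -- `e² = 1` (order of the group) and `e³ = 1`, so `e = 1`
  have hcardAut : Nat.card (F ≃ₐ[ZMod p] F) = 2 := by
    rw [IsGalois.card_aut_eq_finrank, hfin]
  have he2 : e ^ 2 = 1 := by
    rw [← hcardAut]
    exact pow_card_eq_one'
  have he3 : e ^ 3 = 1 := by
    ext y
    rw [pow_succ, pow_two, AlgEquiv.mul_apply, AlgEquiv.mul_apply, AlgEquiv.one_apply, he, he,
      he, hg]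
  have he1 : e = 1 := by
    rw [← he3, pow_succ, he2, one_mul]
  have hx := AlgEquiv.congr_fun he1 x
  rwa [AlgEquiv.one_apply, he] at hx

/-- **The prime of `N` above an inert `p`** (stub `stub_primeAbove` of skeleton v3).  In a
degree-`6` number field `N ∋ ζ, θ` (`ζ² + ζ + 1 = 0`, `θ³ = pq`, `p ≠ q` primes) with a
`ℚ`-automorphism `σ` of order dividing `3`, for a prime `p ≡ 2 (mod 3)`: a maximal ideal `w ∋ p`
is the unique prime above `p` (`3 ∣ e` from `θ`, `f ≥ 2` from `ζ mod w` of order `3` in a field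
of characteristic `p ≡ 2 (mod 3)`, `∑ e f = 6`), `(p) = w³`, `#(𝓞 N ⧸ w) = p²`, and `σ`
(which fixes `w`) induces an automorphism of `𝔽_{p²}` of order dividing `gcd(3, 2) = 1`, i.e.
`σ y ≡ y (mod w)`. [folklore] -/
theorem stub_primeAbove (N : Type) [Field N] [NumberField N] (hN : Module.finrank ℚ N = 6)
    (p q : ℕ) (hp : p.Prime) (hq : q.Prime) (hpq : p ≠ q) (hp3 : p % 3 = 2)
    (ζ θ : N) (hζ : ζ ^ 2 + ζ + 1 = 0) (hθ : θ ^ 3 = ((p * q : ℕ) : N))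
    (σ : N ≃ₐ[ℚ] N) (hσ3 : ∀ x : N, σ (σ (σ x)) = x)
    (w : Ideal (𝓞 N)) [w.IsMaximal] (hpw : (p : 𝓞 N) ∈ w) :
    (∀ w' : Ideal (𝓞 N), w'.IsMaximal → (p : 𝓞 N) ∈ w' → w' = w) ∧
      Ideal.span {(p : 𝓞 N)} = w ^ 3 ∧ Nat.card (𝓞 N ⧸ w) = p ^ 2 ∧
      ∀ y : 𝓞 N, σ • y - y ∈ w := by
  classical
  -- the prime `pℤ` and its image `(p)` in `𝓞 N`
  have hpZ : Prime (p : ℤ) := Nat.prime_iff_prime_int.mp hp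
  set P : Ideal ℤ := Ideal.span {(p : ℤ)} with hPdef
  haveI hPmax : P.IsMaximal :=
    ((Ideal.span_singleton_prime hpZ.ne_zero).mpr hpZ).isMaximal (by simpa using hpZ.ne_zero)
  have hP0 : P ≠ ⊥ := by
    rw [hPdef, Ne, Ideal.span_singleton_eq_bot]
    exact_mod_cast hp.ne_zero
  have hp0 : (p : 𝓞 N) ≠ 0 := by exact_mod_cast hp.ne_zero
  have hPmap : P.map (algebraMap ℤ (𝓞 N)) = Ideal.span {(p : 𝓞 N)} := by
    rw [hPdef, Ideal.map_span, Set.image_singleton, map_natCast]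
  have hPmap0 : P.map (algebraMap ℤ (𝓞 N)) ≠ ⊥ := by
    rw [hPmap, Ne, Ideal.span_singleton_eq_bot]
    exact hp0
  -- maximal ideals containing `p` are the primes over `pℤ` ...
  have hmem : ∀ w' : Ideal (𝓞 N), w'.IsMaximal → (p : 𝓞 N) ∈ w' →
      w' ∈ IsDedekindDomain.primesOverFinset P (𝓞 N) := fun w' hw' hpw' =>
    (IsDedekindDomain.mem_primesOverFinset_iff hP0 _).mpr ⟨hw'.isPrime, liesOver_span_of_natCast_mem hp w' hpw'⟩
  -- ... and each of them has `e = e'`, `f = f'`, `3 ∣ e`, `0 < e`, `2 ≤ f`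
  have hkey : ∀ w' ∈ IsDedekindDomain.primesOverFinset P (𝓞 N),
      P.ramificationIdx' w' = w'.ramificationIdx ℤ ∧ P.inertiaDeg' w' = w'.inertiaDeg ℤ ∧
        3 ∣ w'.ramificationIdx ℤ ∧ 0 < w'.ramificationIdx ℤ ∧ 2 ≤ w'.inertiaDeg ℤ := by
    intro w' hw'
    have hw'' := (IsDedekindDomain.mem_primesOverFinset_iff hP0 _).mp hw'
    haveI : w'.IsPrime := hw''.1
    haveI : w'.LiesOver P := hw''.2
    have hpw' : (p : 𝓞 N) ∈ w' := by
      have h1 : (p : ℤ) ∈ w'.under ℤ := by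
        rw [← Ideal.over_def w' P]
        exact Ideal.mem_span_singleton_self _
      rwa [Ideal.under_def, Ideal.mem_comap, map_natCast] at h1
    have hw'0 : w' ≠ ⊥ := by
      rintro rfl
      exact hp0 (Ideal.mem_bot.mp hpw')
    haveI : w'.IsMaximal := Ideal.IsPrime.isMaximal inferInstance hw'0
    exact ⟨Ideal.ramificationIdx'_eq_ramificationIdx P w' hP0, Ideal.inertiaDeg'_eq_inertiaDeg P w',
      three_dvd_ramificationIdx hp hq hpq hθ w' hpw', Ideal.ramificationIdx_pos w' ℤ,
      two_le_inertiaDeg hp hp3 hζ w' hpw'⟩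
  -- the fundamental identity `∑ e f = 6`, each term being `≥ 6`
  have hsum := Ideal.sum_ramification_inertia (R := ℤ) (S := 𝓞 N) ℚ N hP0
  rw [hN] at hsum
  set g : Ideal (𝓞 N) → ℕ := fun x => P.ramificationIdx' x * P.inertiaDeg' x with hgdef
  have hge : ∀ w' ∈ IsDedekindDomain.primesOverFinset P (𝓞 N), 6 ≤ g w' := by
    intro w' hw'
    obtain ⟨he, hf, ⟨k, hk⟩, hpos, h2⟩ := hkey w' hw'
    simp only [hgdef, he, hf]
    rw [hk] at hpos ⊢
    have hk1 : 1 ≤ k := by omega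
    calc 6 = 3 * 1 * 2 := by norm_num
      _ ≤ 3 * k * w'.inertiaDeg ℤ := Nat.mul_le_mul (Nat.mul_le_mul_left 3 hk1) h2
  have hwmem : w ∈ IsDedekindDomain.primesOverFinset P (𝓞 N) := hmem w ‹_› hpw
  -- uniqueness of the prime above `p`
  have huniq : ∀ w' : Ideal (𝓞 N), w'.IsMaximal → (p : 𝓞 N) ∈ w' → w' = w := by
    intro w' hw' hpw'
    by_contra hne
    have hw'mem := hmem w' hw' hpw'
    have h2 : g w' + g w ≤ 6 := by
      rw [← hsum]
      calc g w' + g w = ∑ x ∈ ({w', w} : Finset (Ideal (𝓞 N))), g x :=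
            (Finset.sum_pair hne).symm
        _ ≤ _ := Finset.sum_le_sum_of_subset
            (Finset.insert_subset_iff.mpr ⟨hw'mem, Finset.singleton_subset_iff.mpr hwmem⟩)
    have h3 := hge w' hw'mem
    have h4 := hge w hwmem
    omega
  -- `e(w | p) = 3`, `f(w | p) = 2`
  have hle : g w ≤ 6 := by
    rw [← hsum]
    exact Finset.single_le_sum (f := g) (fun _ _ => Nat.zero_le _) hwmem
  obtain ⟨he, hf, ⟨k, hk⟩, hpos, h2⟩ := hkey w hwmem
  have hgw : g w = w.ramificationIdx ℤ * w.inertiaDeg ℤ := by simp only [hgdef, he, hf]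
  rw [hgw, hk] at hle
  rw [hk] at hpos
  have h6k : 3 * k * 2 ≤ 6 := le_trans (Nat.mul_le_mul_left _ h2) hle
  have hk1 : k = 1 := by omega
  have hf2 : w.inertiaDeg ℤ = 2 := by
    subst hk1
    omega
  have he3 : w.ramificationIdx ℤ = 3 := by rw [hk, hk1]
  -- `#(𝓞 N ⧸ w) = p²`
  haveI : w.LiesOver P := liesOver_span_of_natCast_mem hp w hpw
  have hcard : Nat.card (𝓞 N ⧸ w) = p ^ 2 := by
    rw [← Submodule.cardQuot_apply, ← Ideal.absNorm_apply, ← Ideal.pow_inertiaDeg p w, hf2]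
  -- `(p) = w³`: all prime factors of `(p)` equal `w`, with multiplicity `e = 3`
  have hspan : Ideal.span {(p : 𝓞 N)} = w ^ 3 := by
    have hI0 : Ideal.span {(p : 𝓞 N)} ≠ ⊥ := hPmap ▸ hPmap0
    have hfac : ∀ v ∈ normalizedFactors (Ideal.span {(p : 𝓞 N)}), v = w := by
      intro v hv
      have hvp : Prime v := prime_of_normalized_factor v hv
      haveI : v.IsMaximal := (Ideal.isPrime_of_prime hvp).isMaximal hvp.ne_zero
      have hle : Ideal.span {(p : 𝓞 N)} ≤ v := Ideal.le_of_dvd (dvd_of_mem_normalizedFactors hv)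
      exact huniq v inferInstance (hle (Ideal.mem_span_singleton_self _))
    have hcount : (normalizedFactors (Ideal.span {(p : 𝓞 N)})).count w = 3 := by
      rw [← he3, Ideal.IsDedekindDomain.ramificationIdx_eq_normalizedFactors_count P w hPmap0,
        hPmap]
    have hrep := Multiset.eq_replicate_of_mem hfac
    rw [hrep, Multiset.count_replicate_self] at hcount
    rw [← Ideal.prod_normalizedFactors_eq_self hI0, hrep, Multiset.prod_replicate, hcount]
  -- `σ` fixes `w` ...
  set τ : 𝓞 N →+* 𝓞 N := MulSemiringAction.toRingHom (N ≃ₐ[ℚ] N) (𝓞 N) σ with hτdef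
  have hτ : ∀ y, τ y = σ • y := fun y => rfl
  have hτsurj : Function.Surjective τ := fun y => ⟨σ⁻¹ • y, by rw [hτ, smul_inv_smul]⟩
  have hcomap : w.comap τ = w := by
    haveI : (w.comap τ).IsMaximal := Ideal.comap_isMaximal_of_surjective τ hτsurj
    refine huniq _ inferInstance ?_
    rw [Ideal.mem_comap, map_natCast]
    exact hpw
  -- ... and induces a ring endomorphism `gbar` of `𝓞 N ⧸ w` with `gbar³ = 1`
  set gbar : 𝓞 N ⧸ w →+* 𝓞 N ⧸ w := Ideal.quotientMap w τ hcomap.ge with hgbar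
  have hgmk : ∀ y : 𝓞 N, gbar (Ideal.Quotient.mk w y) = Ideal.Quotient.mk w (σ • y) :=
    fun y => Ideal.quotientMap_mk
  have hcoe : ∀ y : 𝓞 N, ((σ • y : 𝓞 N) : N) = σ y := fun y => rfl
  have hσy3 : ∀ y : 𝓞 N, σ • σ • σ • y = y := fun y =>
    RingOfIntegers.ext (by rw [hcoe, hcoe, hcoe, hσ3])
  have hg3 : ∀ x : 𝓞 N ⧸ w, gbar (gbar (gbar x)) = x := by
    intro x
    obtain ⟨y, rfl⟩ := Ideal.Quotient.mk_surjective x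
    rw [hgmk, hgmk, hgmk, hσy3]
  -- the residue field has `p²` elements, so `gbar = 1`
  letI := Ideal.Quotient.field w
  haveI : Fact p.Prime := ⟨hp⟩
  haveI : CharP (𝓞 N ⧸ w) p :=
    (CharP.charP_iff_prime_eq_zero hp).mpr (by
      rw [← map_natCast (Ideal.Quotient.mk w), Ideal.Quotient.eq_zero_iff_mem]
      exact hpw)
  refine ⟨huniq, hspan, hcard, fun y => ?_⟩
  rw [← Ideal.Quotient.eq, ← hgmk]
  exact apply_eq_self_of_card_eq_sq hcard gbar hg3 _

end Summit.QuantumAdvantage.QuantumAdvantage.Theorems.LinnikCubicClassGroups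

end
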